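import Summits.AtomisticToContinuum.HydrodynamicLimit.Theorems.EnskogAdjointDualityAdjointEnskogTestFamilyRHalfGaussian
import Summits.AtomisticToContinuum.HydrodynamicLimit.Theorems.EnskogAdjointDualityAdjointEnskogTestFamilyRPsiZeroPrep
import Summits.AtomisticToContinuum.HydrodynamicLimit.Theorems.EnskogAdjointDualityAdjointEnskogTestFamilyRPsiZeroPrep2
import HarnessLib

/-!
# K2R refutation, identity (0), `ψ`-part: the registered stub `stub_psiZero`

Route `EnskogAdjointDuality` of `AtomisticToContinuum/HydrodynamicLimit`, crux K2R
`Summit.AtomisticToContinuum.HydrodynamicLimit.Theses.EnskogAdjointDuality.AdjointEnskogTestFamilyR`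
(stmt-AtomisticToContinuum-11592), line `refutation` (file 3 of 3).

At a constant background (`Y₀`, `ρ₀`, `M = globalMaxwellian`, `k = 2πε ≤ π/2`) the defect inequality is
tested against `Z Θ₀^R`, `Z = ζ(s)cos(2πx₀)`, `Θ₀^R(v) = (1+|v|²)⁻³e^{-|v|²/R}`; at a fixed time
(`z = ζ(s)`, `z' = ζ'(s)`) the hydrodynamic part `ψ = α + ⟪β,v⟫ + γ|v|²/2` of the test function and the
hard-sphere operator `Lψ` on it contribute
`∫_{𝕋³}∫_{ℝ³} Θ₀ (A₀ψ + B₀Lψ)`, `A₀ = −(z'cos(2πx₀) + z v₀(−2π sin(2πx₀)))`, `B₀ = z cos(2πx₀)`.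
Decomposition `Θ₀(A₀ψ + B₀Lψ) = T + F₆ + S_b + S_m` (`k2r_ref_p0_assembly`):
the transport piece `T` and the bounded operator piece `S_b` are `O((|z|+|z'|)(1+|v|²)Θ₀)` with
`∫(1+|v|²)Θ₀ ≤ 40` (files I–II), the odd piece `F₆ = πz sin(2πx₀)γ · Θ₀v₀|v|²` integrates to zero, and
the critical piece `S_m` (second spatial difference of `γ` against `(⟪v,ω⟫₊)³`) is exactly
`−z(π/8)λY₀ρ₀ μ_ε J_R ∫cos(2πx₀)γ`, `J_R = ∫₀^∞E²(1+E)⁻³e^{-E/R} ≍ log R` (file I).  Hence identity (0):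
the `ψ`-part equals the critical term up to `(|z|+|z'|)·Bdd` with `Bdd` depending on `C, λ, Y₀ρ₀` only.

References: C. Cercignani, R. Illner, M. Pulvirenti, *The Mathematical Theory of Dilute Gases* (1994),
§3.1 [CIP1994].
-/

noncomputable section

open MeasureTheory Set Filter Function Metric
open scoped InnerProductSpace Real

namespace Summit.AtomisticToContinuum.HydrodynamicLimit.Theorems.EnskogAdjointDuality

open Literature.MathematicalPhysics.KineticTheory Literature.Analysis.FluidPDE Literature.Analysis.FunctionSpaces

/-- **Identity (0), `ψ`-part — assembly.** For the half-Gaussian data `P₂, P₃` (continuity, bounds,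
marginal identities as hypotheses), coefficients `‖(α,β,γ)‖ ≤ C` and the operator `Lψ` given by its
defining formula: the tested integrand is integrable on `𝕋³ × ℝ³` and its integral equals the critical
term `−z(π/8)λY₀ρ₀ μ_ε J_R ∫cos(2πx₀)γ` up to `(|z|+|z'|)·40(2C + 4πC + 28πλY₀ρ₀C)` (decomposition
`Θ₀(A₀ψ + B₀Lψ) = T + F₆ + S_b + S_m`: `T`, `S_b` bounded by `(1+|v|²)Θ₀`, `∫∫F₆ = 0` by the odd moment,
`S_m` the critical term). [cite: CIP1994, §3.1] -/
theorem k2r_ref_p0_assembly {Y₀ ρ₀ ε lam C : ℝ} (hY₀ : 0 < Y₀) (hρ₀ : 0 < ρ₀) (hlam : 0 < lam)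
    {P₂ P₃ : ℝ → ℝ} (hP₂c : Continuous P₂) (hP₃c : Continuous P₃)
    (hP₂b : ∀ a, 0 ≤ P₂ a ∧ P₂ a ≤ 1 + a ^ 2) (hP₃b : ∀ a, |P₃ a - max a 0 ^ 3| ≤ 3 * (1 + |a|))
    (hint : ∀ (ω : sphere (0 : V3) 1) (v : V3), Integrable fun w : V3 =>
      max ⟪v - w, (ω : V3)⟫_ℝ 0 * (1 + ‖w‖ ^ 2) * globalMaxwellian w)
    (hP₂ : ∀ (ω : sphere (0 : V3) 1) (v : V3),
      ∫ w : V3, max ⟪v - w, (ω : V3)⟫_ℝ 0 * ⟪v - w, (ω : V3)⟫_ℝ * globalMaxwellian w = P₂ ⟪v, (ω : V3)⟫_ℝ)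
    (hP₃ : ∀ (ω : sphere (0 : V3) 1) (v : V3),
      ∫ w : V3, max ⟪v - w, (ω : V3)⟫_ℝ 0 * (⟪v, (ω : V3)⟫_ℝ ^ 2 - ⟪w, (ω : V3)⟫_ℝ ^ 2) *
        globalMaxwellian w = P₃ ⟪v, (ω : V3)⟫_ℝ)
    {cc : T3 → ℝ × V3 × ℝ} (hcc : Continuous cc) (hccC : ∀ x, ‖cc x‖ ≤ C)
    (Lψ : T3 → V3 → ℝ) (hL : ∀ x v, Lψ x v = lam * ∫ ω : sphere (0 : V3) 1, (∫ w : V3,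
        max ⟪v - w, (ω : V3)⟫_ℝ 0 * Y₀ * (ρ₀ * globalMaxwellian w) *
          (((cc x).1 + ⟪(cc x).2.1, v - ⟪v - w, (ω : V3)⟫_ℝ • (ω : V3)⟫_ℝ +
              (cc x).2.2 * ‖v - ⟪v - w, (ω : V3)⟫_ℝ • (ω : V3)‖ ^ 2 / 2) +
            ((cc (x + Torus.proj (ε • (ω : V3)))).1 +
              ⟪(cc (x + Torus.proj (ε • (ω : V3)))).2.1, w + ⟪v - w, (ω : V3)⟫_ℝ • (ω : V3)⟫_ℝ +
              (cc (x + Torus.proj (ε • (ω : V3)))).2.2 * ‖w + ⟪v - w, (ω : V3)⟫_ℝ • (ω : V3)‖ ^ 2 / 2) -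
            ((cc x).1 + ⟪(cc x).2.1, v⟫_ℝ + (cc x).2.2 * ‖v‖ ^ 2 / 2) -
            ((cc (x + Torus.proj (ε • (ω : V3)))).1 + ⟪(cc (x + Torus.proj (ε • (ω : V3)))).2.1, w⟫_ℝ +
              (cc (x + Torus.proj (ε • (ω : V3)))).2.2 * ‖w‖ ^ 2 / 2))) ∂sphereMeasure)
    {R : ℝ} (hR : 1 ≤ R) (z z' : ℝ) :
    Integrable (fun p : T3 × V3 => ((1 + ‖p.2‖ ^ 2) ^ 3)⁻¹ * Real.exp (-‖p.2‖ ^ 2 / R) *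
        ((-(z' * Torus.cosCoord 0 p.1 + z * (p.2 0 * (-(2 * π) * Torus.sinCoord 0 p.1)))) *
            ((cc p.1).1 + ⟪(cc p.1).2.1, p.2⟫_ℝ + (cc p.1).2.2 * ‖p.2‖ ^ 2 / 2) +
          (z * Torus.cosCoord 0 p.1) * Lψ p.1 p.2)) (volume.prod volume) ∧
    |(∫ x : T3, ∫ v : V3, ((1 + ‖v‖ ^ 2) ^ 3)⁻¹ * Real.exp (-‖v‖ ^ 2 / R) *
          ((-(z' * Torus.cosCoord 0 x + z * (v 0 * (-(2 * π) * Torus.sinCoord 0 x)))) *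
              ((cc x).1 + ⟪(cc x).2.1, v⟫_ℝ + (cc x).2.2 * ‖v‖ ^ 2 / 2) +
            (z * Torus.cosCoord 0 x) * Lψ x v)) -
        (-(z * (π / 8) * lam * (Y₀ * ρ₀) *
          (∫ ν : sphere (0 : V3) 1, (1 - Real.cos (2 * π * ε * (ν : V3) 0)) ∂sphereMeasure) *
          (∫ E in Ioi (0 : ℝ), E ^ 2 * (((1 + E) ^ 3)⁻¹ * Real.exp (-E / R))) *
          (∫ x : T3, Torus.cosCoord 0 x * (cc x).2.2)))| ≤
      (|z| + |z'|) * (40 * (2 * C + 4 * π * C + 28 * π * lam * (Y₀ * ρ₀) * C)) := by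
  haveI := isFiniteMeasure_sphereMeasure (E := V3)
  have hA0 : 0 < Y₀ * ρ₀ := mul_pos hY₀ hρ₀
  have hC0 : 0 ≤ C := (norm_nonneg _).trans (hccC 0)
  have hγc : Continuous fun x : T3 => (cc x).2.2 := continuous_snd.comp (continuous_snd.comp hcc)
  have hγC : ∀ x : T3, |(cc x).2.2| ≤ C := fun x => by
    have h := (norm_snd_le (cc x).2).trans ((norm_snd_le _).trans (hccC x))
    rwa [Real.norm_eq_abs] at h
  have hsinc : Continuous (Torus.sinCoord (0 : Fin 3) : T3 → ℝ) :=
    (Torus.isSmooth_sinCoord 0).continuous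
  -- the operator, split into the bounded remainder and the critical `γ`-term
  have hL' := fun x v => (hL x v).trans (congrArg (fun t => lam * t)
    (k2r_ref_p0_L_split (Y₀ := Y₀) (ρ₀ := ρ₀) (ε := ε) hP₂c hP₃c hint hP₂ hP₃ hcc x v))
  -- the four pieces
  set T : T3 × V3 → ℝ := fun p => ((1 + ‖p.2‖ ^ 2) ^ 3)⁻¹ * Real.exp (-‖p.2‖ ^ 2 / R) *
      (-(z' * Torus.cosCoord 0 p.1) *
          ((cc p.1).1 + ⟪(cc p.1).2.1, p.2⟫_ℝ + (cc p.1).2.2 * ‖p.2‖ ^ 2 / 2) +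
        2 * π * z * Torus.sinCoord 0 p.1 * p.2 0 * ((cc p.1).1 + ⟪(cc p.1).2.1, p.2⟫_ℝ)) with hTdef
  set F6 : T3 × V3 → ℝ := fun p => (π * z * Torus.sinCoord 0 p.1 * (cc p.1).2.2) *
      (((1 + ‖p.2‖ ^ 2) ^ 3)⁻¹ * Real.exp (-‖p.2‖ ^ 2 / R) * p.2 0 * ‖p.2‖ ^ 2) with hF6def
  set Sb : T3 × V3 → ℝ := fun p => ((1 + ‖p.2‖ ^ 2) ^ 3)⁻¹ * Real.exp (-‖p.2‖ ^ 2 / R) *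
      (z * lam * (Y₀ * ρ₀) * Torus.cosCoord 0 p.1 * ∫ ω : sphere (0 : V3) 1,
        (⟪(cc (p.1 + Torus.proj (ε • (ω : V3)))).2.1 - (cc p.1).2.1, (ω : V3)⟫_ℝ * P₂ ⟪p.2, (ω : V3)⟫_ℝ +
          ((cc (p.1 + Torus.proj (ε • (ω : V3)))).2.2 - (cc p.1).2.2) / 2 *
            (P₃ ⟪p.2, (ω : V3)⟫_ℝ - max ⟪p.2, (ω : V3)⟫_ℝ 0 ^ 3)) ∂sphereMeasure) with hSbdef
  set Sm : T3 × V3 → ℝ := fun p => ((1 + ‖p.2‖ ^ 2) ^ 3)⁻¹ * Real.exp (-‖p.2‖ ^ 2 / R) *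
      (z * lam * (Y₀ * ρ₀) * Torus.cosCoord 0 p.1 *
        ∫ ω : sphere (0 : V3) 1, ((cc (p.1 + Torus.proj (ε • (ω : V3)))).2.2 - (cc p.1).2.2) / 2 *
          max ⟪p.2, (ω : V3)⟫_ℝ 0 ^ 3 ∂sphereMeasure) with hSmdef
  obtain ⟨hTi, hTb⟩ := k2r_ref_p0_transport hR hcc hccC z z'
  have hTi' : Integrable T (volume.prod volume) := hTi
  obtain ⟨hF6vi, hF6v0, -⟩ := k2r_ref_p0_weight_moments hR
  have hF6fi : Integrable (fun x : T3 => π * z * Torus.sinCoord 0 x * (cc x).2.2) :=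
    ((continuous_const.mul hsinc).mul hγc).integrable_unitAddTorus
  have hF6i : Integrable F6 (volume.prod volume) := hF6fi.mul_prod hF6vi
  have hSbi : Integrable Sb (volume.prod volume) :=
    k2r_ref_p0_Sb_integrable (ε := ε) hR hP₂c hP₃c hP₂b hP₃b hcc hccC (z * lam * (Y₀ * ρ₀))
  obtain ⟨hSmi', hSmv'⟩ := k2r_ref_p0_main_term (ε := ε) hR hγc hγC (z * lam * (Y₀ * ρ₀))
  have hSmi : Integrable Sm (volume.prod volume) := hSmi'
  have hSmv : ∫ p, Sm p ∂(volume.prod volume) = -(z * lam * (Y₀ * ρ₀) * (π / 8) *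
      (∫ ν : sphere (0 : V3) 1, (1 - Real.cos (2 * π * ε * (ν : V3) 0)) ∂sphereMeasure) *
      (∫ E in Ioi (0 : ℝ), E ^ 2 * (((1 + E) ^ 3)⁻¹ * Real.exp (-E / R))) *
      ∫ x : T3, Torus.cosCoord 0 x * (cc x).2.2) := hSmv'
  have hsum : Integrable (T + F6 + Sb + Sm) (volume.prod volume) :=
    ((hTi'.add hF6i).add hSbi).add hSmi
  have hpt : ∀ p : T3 × V3, (T + F6 + Sb + Sm) p =
      ((1 + ‖p.2‖ ^ 2) ^ 3)⁻¹ * Real.exp (-‖p.2‖ ^ 2 / R) *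
        ((-(z' * Torus.cosCoord 0 p.1 + z * (p.2 0 * (-(2 * π) * Torus.sinCoord 0 p.1)))) *
            ((cc p.1).1 + ⟪(cc p.1).2.1, p.2⟫_ℝ + (cc p.1).2.2 * ‖p.2‖ ^ 2 / 2) +
          (z * Torus.cosCoord 0 p.1) * Lψ p.1 p.2) := fun p => by
    simp only [Pi.add_apply, hTdef, hF6def, hSbdef, hSmdef]
    rw [hL' p.1 p.2]
    ring
  refine ⟨hsum.congr (ae_of_all _ hpt), ?_⟩
  -- the integral, in product form
  have hI : (∫ x : T3, ∫ v : V3, ((1 + ‖v‖ ^ 2) ^ 3)⁻¹ * Real.exp (-‖v‖ ^ 2 / R) *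
          ((-(z' * Torus.cosCoord 0 x + z * (v 0 * (-(2 * π) * Torus.sinCoord 0 x)))) *
              ((cc x).1 + ⟪(cc x).2.1, v⟫_ℝ + (cc x).2.2 * ‖v‖ ^ 2 / 2) +
            (z * Torus.cosCoord 0 x) * Lψ x v)) = ∫ p, (T + F6 + Sb + Sm) p ∂(volume.prod volume) := by
    rw [integral_prod _ hsum]
    exact integral_congr_ae (ae_of_all _ fun x =>
      integral_congr_ae (ae_of_all _ fun v => (hpt (x, v)).symm))
  have hsplit : ∫ p, (T + F6 + Sb + Sm) p ∂(volume.prod volume) =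
      (∫ p, (T + Sb) p ∂(volume.prod volume)) + (∫ p, F6 p ∂(volume.prod volume)) +
        ∫ p, Sm p ∂(volume.prod volume) := by
    rw [integral_add' ((hTi'.add hF6i).add hSbi) hSmi, integral_add' (hTi'.add hF6i) hSbi,
      integral_add' hTi' hF6i, integral_add' hTi' hSbi]
    ring
  have hF6v : ∫ p, F6 p ∂(volume.prod volume) = 0 := by
    have h := integral_prod_mul (μ := (volume : Measure T3)) (ν := (volume : Measure V3))
      (fun x : T3 => π * z * Torus.sinCoord 0 x * (cc x).2.2)
      (fun v : V3 => ((1 + ‖v‖ ^ 2) ^ 3)⁻¹ * Real.exp (-‖v‖ ^ 2 / R) * v 0 * ‖v‖ ^ 2)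
    rw [hF6v0, mul_zero] at h
    exact h
  -- the bounded part `T + S_b`
  have hw := k2r_ref_p0_weight_one_add_sq hR
  set K₀ : ℝ := 2 * C + 4 * π * C + 28 * π * lam * (Y₀ * ρ₀) * C with hK₀
  have hK₀0 : 0 ≤ K₀ := by positivity
  set g : T3 × V3 → ℝ := fun p => (|z| + |z'|) * K₀ *
      ((1 + ‖p.2‖ ^ 2) * (((1 + ‖p.2‖ ^ 2) ^ 3)⁻¹ * Real.exp (-‖p.2‖ ^ 2 / R))) with hgdef
  have hgi : Integrable g (volume.prod volume) := (hw.1.comp_snd _).const_mul _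
  have hptw : ∀ p : T3 × V3, ‖(T + Sb) p‖ ≤ g p := by
    intro p
    have hth0 : 0 ≤ ((1 + ‖p.2‖ ^ 2) ^ 3)⁻¹ * Real.exp (-‖p.2‖ ^ 2 / R) := by positivity
    have h1 := hTb p
    have h2 : |Sb p| ≤ |z| * (28 * π * lam * (Y₀ * ρ₀) * C) *
        ((1 + ‖p.2‖ ^ 2) * (((1 + ‖p.2‖ ^ 2) ^ 3)⁻¹ * Real.exp (-‖p.2‖ ^ 2 / R))) := by
      have hb := k2r_ref_p0_Gb_integral_abs_le (ε := ε) hP₂b hP₃b hccC p.1 p.2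
      have hcs : |Torus.cosCoord 0 p.1| ≤ 1 := Torus.abs_cosCoord_le 0 _
      simp only [hSbdef]
      rw [abs_mul, abs_of_nonneg hth0, abs_mul, abs_mul, abs_mul, abs_mul, abs_of_pos hlam,
        abs_of_pos hA0]
      calc ((1 + ‖p.2‖ ^ 2) ^ 3)⁻¹ * Real.exp (-‖p.2‖ ^ 2 / R) *
            (|z| * lam * (Y₀ * ρ₀) * |Torus.cosCoord 0 p.1| *
              |∫ ω : sphere (0 : V3) 1,
                (⟪(cc (p.1 + Torus.proj (ε • (ω : V3)))).2.1 - (cc p.1).2.1, (ω : V3)⟫_ℝ *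
                    P₂ ⟪p.2, (ω : V3)⟫_ℝ +
                  ((cc (p.1 + Torus.proj (ε • (ω : V3)))).2.2 - (cc p.1).2.2) / 2 *
                    (P₃ ⟪p.2, (ω : V3)⟫_ℝ - max ⟪p.2, (ω : V3)⟫_ℝ 0 ^ 3)) ∂sphereMeasure|)
          ≤ ((1 + ‖p.2‖ ^ 2) ^ 3)⁻¹ * Real.exp (-‖p.2‖ ^ 2 / R) *
            (|z| * lam * (Y₀ * ρ₀) * 1 * (4 * π * (7 * C * (1 + ‖p.2‖ ^ 2)))) := by gcongr
        _ = _ := by ring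
    rw [Pi.add_apply, Real.norm_eq_abs]
    have e1 : 0 ≤ |z'| * (4 * π * C + 28 * π * lam * (Y₀ * ρ₀) * C) := by positivity
    have e2 : 0 ≤ |z| * (2 * C) := by positivity
    calc |T p + Sb p| ≤ |T p| + |Sb p| := abs_add_le _ _
      _ ≤ (|z'| * (2 * C) + |z| * (4 * π * C)) *
            ((1 + ‖p.2‖ ^ 2) * (((1 + ‖p.2‖ ^ 2) ^ 3)⁻¹ * Real.exp (-‖p.2‖ ^ 2 / R))) +
          |z| * (28 * π * lam * (Y₀ * ρ₀) * C) *
            ((1 + ‖p.2‖ ^ 2) * (((1 + ‖p.2‖ ^ 2) ^ 3)⁻¹ * Real.exp (-‖p.2‖ ^ 2 / R))) :=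
          add_le_add h1 h2
      _ = (|z'| * (2 * C) + |z| * (4 * π * C + 28 * π * lam * (Y₀ * ρ₀) * C)) *
            ((1 + ‖p.2‖ ^ 2) * (((1 + ‖p.2‖ ^ 2) ^ 3)⁻¹ * Real.exp (-‖p.2‖ ^ 2 / R))) := by ring
      _ ≤ (|z| + |z'|) * K₀ *
            ((1 + ‖p.2‖ ^ 2) * (((1 + ‖p.2‖ ^ 2) ^ 3)⁻¹ * Real.exp (-‖p.2‖ ^ 2 / R))) := by
          apply mul_le_mul_of_nonneg_right _ (by positivity)
          simp only [hK₀]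
          nlinarith [e1, e2]
      _ = g p := by simp only [hgdef]
  have hbound := norm_integral_le_of_norm_le hgi (ae_of_all _ hptw)
  have hgv : ∫ p, g p ∂(volume.prod volume) ≤ (|z| + |z'|) * (40 * K₀) := by
    have h2 := integral_fun_snd (μ := (volume : Measure T3)) (ν := (volume : Measure V3))
      (fun v : V3 => (1 + ‖v‖ ^ 2) * (((1 + ‖v‖ ^ 2) ^ 3)⁻¹ * Real.exp (-‖v‖ ^ 2 / R)))
    simp only [hgdef]
    rw [integral_const_mul, h2, probReal_univ, one_smul]
    have h3 := mul_nonneg (mul_nonneg (add_nonneg (abs_nonneg z) (abs_nonneg z')) hK₀0)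
      (sub_nonneg.2 hw.2)
    nlinarith [h3]
  rw [hI, hsplit, hF6v, hSmv]
  calc _ = ‖∫ p, (T + Sb) p ∂(volume.prod volume)‖ := by rw [Real.norm_eq_abs]; congr 1; ring
    _ ≤ _ := hbound
    _ ≤ _ := hgv

/-- **Registered stub `stub_psiZero`** (identity (0), `ψ`-part; line `refutation` of crux K2R
`Summit.AtomisticToContinuum.HydrodynamicLimit.Theses.EnskogAdjointDuality.AdjointEnskogTestFamilyR`):
tested against `z cos(2πx₀)` with transport coefficient `−(z' cos(2πx₀) + z v₀(−2π sin(2πx₀)))` and the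
critical weight `(1+|v|²)⁻³e^{-|v|²/R}`, the hydrodynamic part `ψ = α + β·v + γ|v|²/2` and the operator `Lψ`
contribute `−z (π/8) λ Y₀ρ₀ μ_ε J_R ∫cos(2πx₀)γ` plus terms bounded by `(|z|+|z'|)·Bdd` uniformly in
`R ≥ 1` — verbatim registered signature (`k2r_ref_p0_assembly` with the half-Gaussian data of
`stub_halfGaussian`). [cite: CIP1994, §3.1] -/
theorem stub_psiZero :
  ∀ (Y₀ ρ₀ ε lam C : ℝ), 0 < Y₀ → 0 < ρ₀ → 0 < ε → 2 * Real.pi * ε ≤ Real.pi / 2 → 0 < lam → 0 ≤ C →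
  ∃ Bdd : ℝ, ∀ (cc : UnitAddTorus (Fin 3) → ℝ × EuclideanSpace ℝ (Fin 3) × ℝ) (κ : UnitAddTorus (Fin 3) → EuclideanSpace ℝ (Fin 3) → ℝ),
    Continuous cc → Continuous (Function.uncurry κ) → (∀ x, ‖cc x‖ ≤ C) →
    (∀ x y, dist (cc x) (cc y) ≤ C * dist x y) → (∀ x v, |κ x v| ≤ C * (1 + ‖v‖ ^ 2)) →
    ∀ (Lψ : UnitAddTorus (Fin 3) → EuclideanSpace ℝ (Fin 3) → ℝ), (∀ x v, Lψ x v = lam * ∫ ω : Metric.sphere (0 : EuclideanSpace ℝ (Fin 3)) 1, (∫ w : EuclideanSpace ℝ (Fin 3),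
        max (inner ℝ (v - w) (ω : EuclideanSpace ℝ (Fin 3))) 0 * Y₀ * (ρ₀ * globalMaxwellian w) *
          (((cc x).1 + inner ℝ (cc x).2.1 (v - inner ℝ (v - w) (ω : EuclideanSpace ℝ (Fin 3)) • (ω : EuclideanSpace ℝ (Fin 3))) + (cc x).2.2 * ‖(v - inner ℝ (v - w) (ω : EuclideanSpace ℝ (Fin 3)) • (ω : EuclideanSpace ℝ (Fin 3)))‖ ^ 2 / 2) +
            ((cc (x + Torus.proj (ε • (ω : EuclideanSpace ℝ (Fin 3))))).1 + inner ℝ (cc (x + Torus.proj (ε • (ω : EuclideanSpace ℝ (Fin 3))))).2.1 (w + inner ℝ (v - w) (ω : EuclideanSpace ℝ (Fin 3)) • (ω : EuclideanSpace ℝ (Fin 3))) + (cc (x + Torus.proj (ε • (ω : EuclideanSpace ℝ (Fin 3))))).2.2 * ‖(w + inner ℝ (v - w) (ω : EuclideanSpace ℝ (Fin 3)) • (ω : EuclideanSpace ℝ (Fin 3)))‖ ^ 2 / 2) -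
            ((cc x).1 + inner ℝ (cc x).2.1 v + (cc x).2.2 * ‖v‖ ^ 2 / 2) -
            ((cc (x + Torus.proj (ε • (ω : EuclideanSpace ℝ (Fin 3))))).1 + inner ℝ (cc (x + Torus.proj (ε • (ω : EuclideanSpace ℝ (Fin 3))))).2.1 w + (cc (x + Torus.proj (ε • (ω : EuclideanSpace ℝ (Fin 3))))).2.2 * ‖w‖ ^ 2 / 2))) ∂sphereMeasure) →
    ∀ R : ℝ, 1 ≤ R → ∀ z z' : ℝ,
    Integrable (fun p : UnitAddTorus (Fin 3) × EuclideanSpace ℝ (Fin 3) => ((1 + ‖p.2‖ ^ 2) ^ 3)⁻¹ * Real.exp (-‖p.2‖ ^ 2 / R) * ((-(z' * Torus.cosCoord 0 p.1 + z * (p.2 0 * (-(2 * Real.pi) * Torus.sinCoord 0 p.1)))) * ((cc p.1).1 + inner ℝ (cc p.1).2.1 p.2 + (cc p.1).2.2 * ‖p.2‖ ^ 2 / 2) + (z * Torus.cosCoord 0 p.1) * Lψ p.1 p.2)) (volume.prod volume) ∧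
    |(∫ x : UnitAddTorus (Fin 3), ∫ v : EuclideanSpace ℝ (Fin 3), ((1 + ‖v‖ ^ 2) ^ 3)⁻¹ * Real.exp (-‖v‖ ^ 2 / R) * ((-(z' * Torus.cosCoord 0 x + z * (v 0 * (-(2 * Real.pi) * Torus.sinCoord 0 x)))) * ((cc x).1 + inner ℝ (cc x).2.1 v + (cc x).2.2 * ‖v‖ ^ 2 / 2) + (z * Torus.cosCoord 0 x) * Lψ x v)) -
        (-(z * (Real.pi / 8) * lam * (Y₀ * ρ₀) * (∫ ν : Metric.sphere (0 : EuclideanSpace ℝ (Fin 3)) 1, (1 - Real.cos (2 * Real.pi * ε * (ν : EuclideanSpace ℝ (Fin 3)) 0)) ∂sphereMeasure) *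
          (∫ E in Set.Ioi (0 : ℝ), E ^ 2 * (((1 + E) ^ 3)⁻¹ * Real.exp (-E / R))) * (∫ x : UnitAddTorus (Fin 3), Torus.cosCoord 0 x * (cc x).2.2)))| ≤ (|z| + |z'|) * Bdd := by
  intro Y₀ ρ₀ ε lam C hY₀ hρ₀ _hε _hk hlam _hC
  obtain ⟨⟨-, hP₂c, hP₃c⟩, -, hP₂b, hP₃b, hmarg, -⟩ := stub_halfGaussian
  exact ⟨40 * (2 * C + 4 * π * C + 28 * π * lam * (Y₀ * ρ₀) * C),
    fun cc κ hcc _ hccC _ _ Lψ hL R hR z z' =>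
      k2r_ref_p0_assembly hY₀ hρ₀ hlam hP₂c hP₃c hP₂b hP₃b (fun ω v => (hmarg ω v).1)
        (fun ω v => (hmarg ω v).2.2.1) (fun ω v => (hmarg ω v).2.2.2) hcc hccC Lψ hL hR z z'⟩

end Summit.AtomisticToContinuum.HydrodynamicLimit.Theorems.EnskogAdjointDuality
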